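import Summits.QuantumFields.YangMills.Theorems.UnitScaleTiltProp7ResumTermDivLipschitz
import Summits.QuantumFields.YangMills.Theorems.UnitScaleTiltProp7SiteTermJunction
import HarnessLib

/-!
# Prop 7, route-R E′, (E1-c) brick F4c(iv-a) — THE RESUMMED PART OF `P₂` UNDER `ℓ²D*_W`, PACKAGED IN THE X-CURRENCY: `≤ 2M_ψ·ρ(x;ψ−ψ′) + κM_{ψ−ψ′}·ρ(x;ψ′) + |ι|ℓ²(κδδ_d + θ(δ_d + 4δ′m_d)δ′)`

Route `UnitScaleTilt`, crux K1 child «MinimiserStabilityRegPr» (`stmt-QuantumFields-19200`), cell ym3-torus, width seat px15 (gen 2); pen «px15 g2: (E1-c) GO-LOCATE» (★p1 g15,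
2026-08-28T20:45:05Z), LOCATE `LOCATE-E1C-DIVLIPSCHITZ-px15g2.md` §6 (F4).  THEOREMS ONLY (0 `def`, 0 `sorry`); `--supports stmt-QuantumFields-19200`, count-neutral.
YM₃ on T³ is a ladder rung (R3), not the Clay problem; nothing here claims the stub, the crux, d = 4 or the mass gap.

WHAT.  The resummed part of the pure-gauge chart remainder is the bond field `μ,y ↦ ĉ(ψ y)(c•D_μψ(y))` (F3c ✓p671341; `ĉ` = F4b ✓p671886's coefficient, here generic with its rows as
hypotheses: additivity, equivariance, cone size `2‖λ‖‖Z‖` on `‖λ‖ ≤ ½`, local Lipschitz `κ` and four-point `θ` on `‖λ‖ ≤ R₀`).  Combining F4c(ii) ✓p672165 `norm_divB_coeffDiff_le` (the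
`D*`-identity and its bond sums) with F4c(iii) ⧗p672707 (`norm_siteTerm_le`, `norm_siteDiffTerm_le`: the ρ₃-junction of the two site terms) gives, at every site `x`, with the sup rows
`‖ψ‖ ≤ m ≤ ½`, `‖ψ′‖ ≤ m′`, `‖ψ−ψ′‖ ≤ m_d`, `‖D_μψ‖ ≤ δ`, `‖D_μψ′‖ ≤ δ′`, `‖D_μ(ψ−ψ′)‖ ≤ δ_d` (all fields pinned on `C`, `d` a potential toward `C`, `|c| ≤ 1`):
  `ℓ²‖D*[ĉ(ψ)(c•Dψ) − ĉ(ψ′)(c•Dψ′)](x)‖ ≤ 2·max(ℓδ, m)·ρ_x(ψ−ψ′) + κ·max(ℓδ_d, m_d)·ρ_x(ψ′) + |ι|·ℓ²·(κ·δ·δ_d + θ·(δ_d + 4δ′m_d)·δ′)`,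
  `ρ_x(f) := ℓ·min(d x, ℓ)·‖D*(c•Df)(x)‖` (≤ ★routeR-w3's `ρ₃(f)`), and `ℓ²δδ_d = (ℓδ)(ℓδ_d)` etc. are products of X-currency rows — i.e. `≤ C·(p ψ + p ψ′)·p(ψ − ψ′)`.
★★★ `norm_divB_resumPart_le`; tools `covD_sub`, `R_inv_R`, `norm_covDstar_eq_norm_covD`.  HONEST SCOPE.  Bookkeeping ([folklore]); the NONLINEAR part `𝒩` (crude rule F1 + F3c
`norm_gaugeNonlin_sub_le`) and the final `(p,q)`-packaging for ✓p667460 are F4c(iv-b,c).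

References: T. Bałaban, CMP 99 (1985) 389–434 [Balaban1985BackgroundPropagators] ((3.8) p.392); CMP 98 (1985) 17–51 [Balaban1985Averaging] ((32)–(34) p.22).
-/

set_option autoImplicit false

noncomputable section

open scoped BigOperators Matrix.Norms.L2Operator Matrix
open NormedSpace

namespace Summit.QuantumFields.YangMills.Theorems.Prop7ResumPartPackaged

open Literature.MathematicalPhysics.QuantumFieldTheory.Balaban1983to89
open Finset
open B9Eq39Adjoint (R R_def R_add R_sub covD covDstar divB)
open Summit.QuantumFields.YangMills.Theorems.Prop7ResumTermDivLipschitz (norm_divB_coeffDiff_le divB_sub covDstar_sub)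
open Summit.QuantumFields.YangMills.Theorems.Prop7SiteTermJunction (norm_siteTerm_le norm_siteDiffTerm_le)

variable {n : Type*} [Fintype n] [DecidableEq n] [Nonempty n]
variable {S : Type*} {ι : Type*} (T : ι → Equiv.Perm S) (U : ι → S → (Matrix n n ℂ)ˣ)

omit [Nonempty n] in
/-- `D_μ` is additive: `D_μ(f − g) = D_μf − D_μg`. [folklore] -/
theorem covD_sub (μ : ι) (f g : S → Matrix n n ℂ) (x : S) :
    covD T U μ (fun y => f y - g y) x = covD T U μ f x - covD T U μ g x := by
  simp only [covD, R_sub]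
  abel

omit [Nonempty n] in
/-- `R(u⁻¹)(R(u)M) = M`. [folklore] -/
theorem R_inv_R (u : (Matrix n n ℂ)ˣ) (M : Matrix n n ℂ) : R u⁻¹ (R u M) = M := by
  simp only [R, inv_inv, ← mul_assoc, Units.inv_mul, one_mul, Units.inv_mul_cancel_right]

omit [Nonempty n] in
/-- `‖D*_μ f(x)‖ = ‖D_μ f(x − e_μ)‖` for norm-preserving transports (`R(U)⁻¹D_μf(y) = −D*_μf(x)`). [cite: Balaban1985BackgroundPropagators, (3.8) p.392, (3.5) p.391] -/
theorem norm_covDstar_eq_norm_covD (hRn : ∀ μ x (M : Matrix n n ℂ), ‖R (U μ x)⁻¹ M‖ = ‖M‖) (μ : ι) (f : S → Matrix n n ℂ) (x : S) :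
    ‖covDstar T U μ f x‖ = ‖covD T U μ f ((T μ).symm x)‖ := by
  have e : R (U μ ((T μ).symm x))⁻¹ (covD T U μ f ((T μ).symm x)) = -covDstar T U μ f x := by
    simp only [covD, covDstar, R_sub, R_inv_R, Equiv.apply_symm_apply, neg_sub]
  rw [← hRn μ ((T μ).symm x) (covD T U μ f ((T μ).symm x)), e, norm_neg]

variable [Fintype ι]

omit [Nonempty n] in
/-- ★★★ **THE RESUMMED PART OF `P₂` UNDER `ℓ²D*`, IN THE X-CURRENCY** (see the module docstring for the letters). [cite: Balaban1985Averaging, (32)-(34) p.22] -/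
theorem norm_divB_resumPart_le
    (hR : ∀ μ x (M : Matrix n n ℂ), ‖R (U μ x) M‖ = ‖M‖) (hRn : ∀ μ x (M : Matrix n n ℂ), ‖R (U μ x)⁻¹ M‖ = ‖M‖)
    (ĉ : Matrix n n ℂ → Matrix n n ℂ → Matrix n n ℂ) (hĉ : ∀ lam Z Z', ĉ lam (Z - Z') = ĉ lam Z - ĉ lam Z')
    (hĉsum : ∀ lam (f : ι → Matrix n n ℂ), ĉ lam (∑ μ, f μ) = ∑ μ, ĉ lam (f μ))
    (hequiv : ∀ μ y lam Z, R (U μ y)⁻¹ (ĉ lam Z) = ĉ (R (U μ y)⁻¹ lam) (R (U μ y)⁻¹ Z))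
    (hcone : ∀ lam Z, ‖lam‖ ≤ 1 / 2 → ‖ĉ lam Z‖ ≤ 2 * ‖lam‖ * ‖Z‖)
    {R₀ κ θ : ℝ} (hκ0 : 0 ≤ κ) (hθ0 : 0 ≤ θ)
    (hκ : ∀ lam lam' Z, ‖lam‖ ≤ R₀ → ‖lam'‖ ≤ R₀ → ‖ĉ lam Z - ĉ lam' Z‖ ≤ κ * ‖lam - lam'‖ * ‖Z‖)
    (hθ : ∀ a b a' b' Z, ‖a‖ ≤ R₀ → ‖b‖ ≤ R₀ → ‖a'‖ ≤ R₀ → ‖b'‖ ≤ R₀ →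
      ‖(ĉ a Z - ĉ b Z) - (ĉ a' Z - ĉ b' Z)‖ ≤ θ * (‖(a - b) - (a' - b')‖ + 2 * ‖a' - b'‖ * (‖a - a'‖ + ‖b - b'‖)) * ‖Z‖)
    {c : ℂ} (hc : ‖c‖ ≤ 1)
    (ψ ψ' : S → Matrix n n ℂ) {m m' md δ δ' δd : ℝ}
    (hm : ∀ y, ‖ψ y‖ ≤ m) (hmR : m ≤ R₀) (hmhalf : m ≤ 1 / 2) (hm' : ∀ y, ‖ψ' y‖ ≤ m') (hm'R : m' ≤ R₀) (hmd : ∀ y, ‖ψ y - ψ' y‖ ≤ md)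
    (hδ0 : 0 ≤ δ) (hδ : ∀ μ y, ‖covD T U μ ψ y‖ ≤ δ) (hδ'0 : 0 ≤ δ') (hδ' : ∀ μ y, ‖covD T U μ ψ' y‖ ≤ δ')
    (hδd0 : 0 ≤ δd) (hδd : ∀ μ y, ‖covD T U μ (fun z => ψ z - ψ' z) y‖ ≤ δd)
    (C : Set S) (hC : ∀ y ∈ C, ψ y = 0) (hC' : ∀ y ∈ C, ψ' y = 0)
    (d : S → ℕ) (hd : ∀ y, y ∉ C → ∃ μ, d (T μ y) + 1 ≤ d y ∨ d ((T μ).symm y) + 1 ≤ d y) (ℓ : ℕ) (x : S) :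
    (ℓ : ℝ) ^ 2 * ‖divB T U (fun μ y => ĉ (ψ y) (c • covD T U μ ψ y) - ĉ (ψ' y) (c • covD T U μ ψ' y)) x‖
      ≤ 2 * max ((ℓ : ℝ) * δ) m * ((ℓ : ℝ) * min (d x : ℝ) ℓ * ‖divB T U (fun μ y => c • covD T U μ (fun z => ψ z - ψ' z) y) x‖)
        + κ * max ((ℓ : ℝ) * δd) md * ((ℓ : ℝ) * min (d x : ℝ) ℓ * ‖divB T U (fun μ y => c • covD T U μ ψ' y) x‖)
        + (Fintype.card ι : ℝ) * (ℓ : ℝ) ^ 2 * (κ * δ * δd + θ * (δd + 4 * δ' * md) * δ') := by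
  have hmd0 : 0 ≤ md := (norm_nonneg _).trans (hmd x)
  -- F4c(ii)
  have hmain := norm_divB_coeffDiff_le T U hRn ĉ hĉ hĉsum hequiv hκ hθ ψ ψ' (fun y => (hm y).trans hmR) (fun y => (hm' y).trans hm'R)
    (fun μ y => c • covD T U μ ψ y) (fun μ y => c • covD T U μ ψ' y) x
  -- the datum difference is the datum of the difference
  have hBdiff : (fun μ y => c • covD T U μ ψ y - c • covD T U μ ψ' y) = fun μ y => c • covD T U μ (fun z => ψ z - ψ' z) y := by
    funext μ y; rw [covD_sub, smul_sub]
  rw [hBdiff] at hmain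
  -- site term 1 (cone × path bound on ψ)
  have h1 := norm_siteTerm_le T U hR ĉ hcone ψ hδ0 hδ hm hmhalf C hC d hd ℓ x
    (divB T U (fun μ y => c • covD T U μ (fun z => ψ z - ψ' z) y) x)
  -- site term 2 (Lipschitz × path bound on ψ − ψ′)
  have h2 := norm_siteDiffTerm_le T U hR ĉ hκ0 hκ ψ ψ' (fun y => (hm y).trans hmR) (fun y => (hm' y).trans hm'R) hδd0 hδd hmd C
    (fun y hy => by rw [hC y hy, hC' y hy, sub_zero]) d hd ℓ x (divB T U (fun μ y => c • covD T U μ ψ' y) x)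
  -- bond rows
  have hHd : ∀ μ y, ‖c • covD T U μ (fun z => ψ z - ψ' z) y‖ ≤ δd := fun μ y => by
    rw [norm_smul]; nlinarith [hδd μ y, norm_nonneg c, norm_nonneg (covD T U μ (fun z => ψ z - ψ' z) y)]
  have hH' : ∀ μ y, ‖c • covD T U μ ψ' y‖ ≤ δ' := fun μ y => by
    rw [norm_smul]; nlinarith [hδ' μ y, norm_nonneg c, norm_nonneg (covD T U μ ψ' y)]
  have hDs : ∀ μ, ‖covDstar T U μ ψ x‖ ≤ δ := fun μ => by rw [norm_covDstar_eq_norm_covD T U hRn]; exact hδ μ _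
  have hDs' : ∀ μ, ‖covDstar T U μ ψ' x‖ ≤ δ' := fun μ => by rw [norm_covDstar_eq_norm_covD T U hRn]; exact hδ' μ _
  have hDsd : ∀ μ, ‖covDstar T U μ ψ x - covDstar T U μ ψ' x‖ ≤ δd := fun μ => by
    rw [← covDstar_sub, norm_covDstar_eq_norm_covD T U hRn]; exact hδd μ _
  have h3 : κ * ∑ μ, ‖covDstar T U μ ψ x‖ * ‖c • covD T U μ ψ ((T μ).symm x) - c • covD T U μ ψ' ((T μ).symm x)‖
      ≤ κ * (Fintype.card ι * (δ * δd)) := by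
    refine mul_le_mul_of_nonneg_left ?_ hκ0
    calc ∑ μ, ‖covDstar T U μ ψ x‖ * ‖c • covD T U μ ψ ((T μ).symm x) - c • covD T U μ ψ' ((T μ).symm x)‖ ≤ ∑ _μ : ι, δ * δd :=
          Finset.sum_le_sum fun μ _ => by
            rw [← smul_sub, ← covD_sub]
            exact mul_le_mul (hDs μ) (hHd μ _) (norm_nonneg _) hδ0
      _ = Fintype.card ι * (δ * δd) := by rw [Finset.sum_const, nsmul_eq_mul, Finset.card_univ]
  have h4 : θ * ∑ μ, (‖covDstar T U μ ψ x - covDstar T U μ ψ' x‖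
        + 2 * ‖covDstar T U μ ψ' x‖ * (‖ψ ((T μ).symm x) - ψ' ((T μ).symm x)‖ + ‖ψ x - ψ' x‖)) * ‖c • covD T U μ ψ' ((T μ).symm x)‖
      ≤ θ * (Fintype.card ι * ((δd + 4 * δ' * md) * δ')) := by
    refine mul_le_mul_of_nonneg_left ?_ hθ0
    calc _ ≤ ∑ _μ : ι, (δd + 4 * δ' * md) * δ' := Finset.sum_le_sum fun μ _ => by
            have ha : ‖covDstar T U μ ψ x - covDstar T U μ ψ' x‖
                + 2 * ‖covDstar T U μ ψ' x‖ * (‖ψ ((T μ).symm x) - ψ' ((T μ).symm x)‖ + ‖ψ x - ψ' x‖) ≤ δd + 4 * δ' * md := by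
              have hb : 2 * ‖covDstar T U μ ψ' x‖ * (‖ψ ((T μ).symm x) - ψ' ((T μ).symm x)‖ + ‖ψ x - ψ' x‖) ≤ 2 * δ' * (md + md) :=
                mul_le_mul (mul_le_mul_of_nonneg_left (hDs' μ) (by norm_num)) (add_le_add (hmd _) (hmd _)) (by positivity) (by positivity)
              linarith [hDsd μ]
            exact mul_le_mul ha (hH' μ _) (norm_nonneg _) (by positivity)
      _ = Fintype.card ι * ((δd + 4 * δ' * md) * δ') := by rw [Finset.sum_const, nsmul_eq_mul, Finset.card_univ]
  have hℓ2 : 0 ≤ (ℓ : ℝ) ^ 2 := sq_nonneg _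
  have hmain2 := mul_le_mul_of_nonneg_left hmain hℓ2
  have h34 : (ℓ : ℝ) ^ 2 * (κ * ∑ μ, ‖covDstar T U μ ψ x‖ * ‖c • covD T U μ ψ ((T μ).symm x) - c • covD T U μ ψ' ((T μ).symm x)‖)
      + (ℓ : ℝ) ^ 2 * (θ * ∑ μ, (‖covDstar T U μ ψ x - covDstar T U μ ψ' x‖
          + 2 * ‖covDstar T U μ ψ' x‖ * (‖ψ ((T μ).symm x) - ψ' ((T μ).symm x)‖ + ‖ψ x - ψ' x‖)) * ‖c • covD T U μ ψ' ((T μ).symm x)‖)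
      ≤ (Fintype.card ι : ℝ) * (ℓ : ℝ) ^ 2 * (κ * δ * δd + θ * (δd + 4 * δ' * md) * δ') := by
    have := add_le_add (mul_le_mul_of_nonneg_left h3 hℓ2) (mul_le_mul_of_nonneg_left h4 hℓ2)
    refine this.trans (le_of_eq ?_)
    ring
  linarith [hmain2, h1, h2, h34]

end Summit.QuantumFields.YangMills.Theorems.Prop7ResumPartPackaged

end
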